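import Summits.AtomisticToContinuum.HydrodynamicLimit.Theorems.BoxDissipativeWeakStrongFluxClosureKinStaticGeneral
import Summits.AtomisticToContinuum.HydrodynamicLimit.Theorems.BoxDissipativeWeakStrongLocalGibbsFineScaleKernels
import HarnessLib

/-!
# Crux `FluxClosure` (stmt-AtomisticToContinuum-9902, route BoxDissipativeWeakStrong), line `registered`:
# static kinetic isotropy under EVERY local Gibbs measure with continuous profiles (sub-goal G2, "rung 0.5")

Support file (`--supports stmt-AtomisticToContinuum-9902`) of the lead prover for the crux
`Summit.AtomisticToContinuum.HydrodynamicLimit.Theses.BoxDissipativeWeakStrong.FluxClosure`. The open stub K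
(`stub_kineticIsotropy`) of the crux skeleton asserts that the traceless box peculiar velocity covariance
`A = Ŝ - m̂⊗m̂/ρ̂ - ρ̂θ̂𝟙` of the cube-kernel box fields, tested against `∇w` and integrated in space–time ALONG THE
DETERMINISTIC FLOW, tends to `0` in `L¹(P_N)` at every kinetic window. This file proves its STATIC half for
GENERAL data (registered sub-goal G2 `kineticIsotropy_static_localGibbs`): under the local Gibbs MEASURE
`localGibbsMeasure σ a₀ u₀ θ₀ N` of ANY continuous profiles (`a₀, θ₀ > 0`, `σ ≤ 1/2`) and for every bounded
measurable matrix field `G` (`|Gᵢⱼ| ≤ B`),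
`E |∫ₓ Σᵢⱼ Aᵢⱼ(z, x) Gᵢⱼ(x) dx| ≤ B (C (((N+1)l³)^{-1/2} + ((N+1)l³)⁻¹) + ε)` for all windows `l ≤ l₀(ε)`,
uniformly in `N` — flux-level kinetic local equilibrium holds for every local equilibrium STATE. What K adds, and
what remains open, is exactly the PROPAGATION of this estimate along the hard-sphere flow at positive times
(Spohn 1991, Part I §3.3: no theorem for deterministic dynamics). The constant-profile case is sub-goal E6
(`FluxClosureEq.E6.kineticIsotropy_static_homogeneous`), whose flow version E7 is the rung-0 theorem.

Proof: the general-kernel Gaussian statics `FluxClosureEq.G1.kinStatic_lintegral_localGibbs_general_le` (sub-goal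
G1, landed) for the cube kernel `K_l` (`0 ≤ K_l ≤ l⁻³`, jointly measurable, unit mass in the centre variable), whose
locality hypothesis — `K_l(x, y) ≠ 0 ⇒ ‖u₀ y - u₀ x‖ ≤ δu`, `|θ₀ y - θ₀ x| ≤ δθ` — holds with `δu² + δθ` as small
as we please once `l ≤ l₀`, by UNIFORM continuity of `u₀, θ₀` on the compact torus (`K_l(x, y) ≠ 0` forces
`dist y x < l/2` in the sup metric of `𝕋³ = (Fin 3 → AddCircle 1)`, `LGFS.dist_lt_of_boxK_ne_zero`).

No definitions. References: H. Spohn, *Large Scale Dynamics of Interacting Particles* (1991), Part I §2.3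
(local equilibrium states), §3.3 (the local equilibrium assumption along the dynamics).
-/

noncomputable section

namespace Summit.AtomisticToContinuum.HydrodynamicLimit.Theorems
namespace FluxClosureEq.G2

open scoped BigOperators Topology Classical MeasureTheory ProbabilityTheory InnerProductSpace ENNReal
open Filter Set Function MeasureTheory ProbabilityTheory
open Literature.MathematicalPhysics.KineticTheory Literature.Analysis.FluidPDE Literature.Analysis.FunctionSpaces
open Summit.AtomisticToContinuum.HydrodynamicLimit.Theses.BoxDissipativeWeakStrong

/-- **Sub-goal G2 of crux `FluxClosure` (static kinetic isotropy under every local Gibbs measure; rung 0.5 of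
stub K).** For `σ ≤ 1/2` and continuous profiles `a₀, θ₀ > 0`, `u₀` there is `C ≥ 0` such that for every
`ε > 0` there is a window threshold `l₀ > 0` with: for every `N`, every window `0 < l ≤ l₀` and every bounded
measurable matrix field `G` (`|Gᵢⱼ| ≤ B`), under `localGibbsMeasure σ a₀ u₀ θ₀ N` the traceless box peculiar
velocity covariance of the cube-kernel box fields tested against `G` satisfies
`E |∫ₓ Σᵢⱼ Aᵢⱼ Gᵢⱼ| ≤ B (C (((N+1)l³)^{-1/2} + ((N+1)l³)⁻¹) + ε)`. Proof: module docstring. -/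
theorem kineticIsotropy_static_localGibbs : ∀ (σ : ℝ) (a₀ θ₀ : T3 → ℝ) (u₀ : T3 → V3), σ ≤ 1 / 2 → Continuous a₀ → Continuous θ₀ → Continuous u₀ → (∀ x, 0 < a₀ x) → (∀ x, 0 < θ₀ x) → ∃ C : ℝ, 0 ≤ C ∧ ∀ ε : ℝ, 0 < ε → ∃ l₀ : ℝ, 0 < l₀ ∧ ∀ (N : ℕ) (l : ℝ), 0 < l → l ≤ l₀ → ∀ (G : T3 → Fin 3 → Fin 3 → ℝ) (B : ℝ), (∀ i j, Measurable fun x => G x i j) → (∀ x i j, |G x i j| ≤ B) → let K := fun (x y : T3) => indicator {y' : T3 | ∀ i, ‖y' i - x i‖ < l / 2} (fun _ => (l ^ 3)⁻¹) y; let Dn := fun (z : Config (N + 1) (Fin 3) T3) (x : T3) => empiricalDensityField z (K x); let Mm := fun (z : Config (N + 1) (Fin 3) T3) (x : T3) => empiricalMomentumField z (K x); let En := fun (z : Config (N + 1) (Fin 3) T3) (x : T3) => empiricalEnergyField z (K x); let Sk := fun (z : Config (N + 1) (Fin 3) T3) (x : T3) (i j : Fin 3) => ∫ y, K x y.1 *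 (y.2 i * y.2 j) ∂(empiricalMeasure z); let Th := fun (r : ℝ) (m : V3) (E : ℝ) => 2 / 3 * (E / r - ‖m‖ ^ 2 / (2 * r ^ 2)); ∫⁻ z, ENNReal.ofReal (|∫ x, ∑ i, ∑ j, (Sk z x i j - Mm z x i * Mm z x j / Dn z x - (if i = j then Dn z x * Th (Dn z x) (Mm z x) (En z x) else 0)) * G x i j|) ∂(localGibbsMeasure σ a₀ u₀ θ₀ N) ≤ ENNReal.ofReal (B * (C * (Real.sqrt ((((N : ℝ) + 1) * l ^ 3)⁻¹) + (((N : ℝ) + 1) * l ^ 3)⁻¹) + ε)) := by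
  intro σ a₀ θ₀ u₀ hσ ha hθ hu ha0 hθ0
  obtain ⟨C, hC0, hG1⟩ := FluxClosureEq.G1.kinStatic_lintegral_localGibbs_general_le σ a₀ θ₀ u₀ hσ ha hθ hu ha0 hθ0
  refine ⟨C, hC0, fun ε hε => ?_⟩
  -- smallness budget for the locality errors: C (δθ + δu²) ≤ ε
  set η : ℝ := ε / (2 * (C + 1)) with hη
  have hC1 : 0 < C + 1 := by linarith
  have hη0 : 0 < η := by rw [hη]; positivity
  have hmin0 : 0 < min η 1 := lt_min hη0 one_pos
  -- uniform continuity of the profiles on the compact torus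
  obtain ⟨ρu, hρu0, hρu⟩ := Metric.uniformContinuous_iff.1 (CompactSpace.uniformContinuous_of_continuous hu)
    (min η 1) hmin0
  obtain ⟨ρθ, hρθ0, hρθ⟩ := Metric.uniformContinuous_iff.1 (CompactSpace.uniformContinuous_of_continuous hθ) η hη0
  refine ⟨min (min ρu ρθ) 1, lt_min (lt_min hρu0 hρθ0) one_pos, ?_⟩
  intro N l hl hll0 G B hGm hGB
  dsimp only
  have hl1 : l ≤ 1 := hll0.trans (min_le_right _ _)
  have hlu : l ≤ ρu := hll0.trans ((min_le_left _ _).trans (min_le_left _ _))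
  have hlθ : l ≤ ρθ := hll0.trans ((min_le_left _ _).trans (min_le_right _ _))
  -- locality of the cube kernel for the profiles
  have hloc : ∀ x y : T3, Set.indicator {y' : T3 | ∀ i, ‖y' i - x i‖ < l / 2} (fun _ => (l ^ 3)⁻¹) y ≠ 0 →
      ‖u₀ y - u₀ x‖ ≤ min η 1 ∧ |θ₀ y - θ₀ x| ≤ η := by
    intro x y hK
    have hd : dist y x < l / 2 := LGFS.dist_lt_of_boxK_ne_zero hl hK
    have hdl : dist y x < l := hd.trans_le (by linarith)
    refine ⟨?_, ?_⟩
    · have := hρu (hdl.trans_le hlu)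
      rw [dist_eq_norm] at this
      exact this.le
    · have := hρθ (hdl.trans_le hlθ)
      rw [Real.dist_eq] at this
      exact this.le
  have h := hG1 N (fun x y => Set.indicator {y' : T3 | ∀ i, ‖y' i - x i‖ < l / 2} (fun _ => (l ^ 3)⁻¹) y)
    ((l ^ 3)⁻¹) (min η 1) η (LGFS.measurable_boxK_uncurry l) (fun x y => LGFS.boxK_nonneg hl.le x y)
    (fun x y => LGFS.boxK_le hl.le x y) (fun q => FluxClosureK.integral_boxK_left hl hl1 q) hmin0.le hη0.le hloc
    G B hGm hGB
  refine h.trans (ENNReal.ofReal_le_ofReal ?_)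
  have hB0 : 0 ≤ B := (abs_nonneg _).trans (hGB 0 0 0)
  have hn : (((N : ℝ) + 1))⁻¹ * (l ^ 3)⁻¹ = (((N : ℝ) + 1) * l ^ 3)⁻¹ := by rw [← mul_inv]
  rw [hn]
  -- the locality budget: C (η + (min η 1)²) ≤ ε
  have hm1 : min η 1 ^ 2 ≤ η := by
    have h1 : min η 1 ≤ 1 := min_le_right _ _
    have h2 : min η 1 ≤ η := min_le_left _ _
    nlinarith [hmin0.le]
  have hbud : C * (η + min η 1 ^ 2) ≤ ε := by
    have h2 : C * (η + min η 1 ^ 2) ≤ C * (2 * η) := by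
      apply mul_le_mul_of_nonneg_left _ hC0
      linarith
    have h3 : C * (2 * η) = ε * (C / (C + 1)) := by
      rw [hη]; field_simp
    have h4 : C / (C + 1) ≤ 1 := by rw [div_le_one hC1]; linarith
    calc C * (η + min η 1 ^ 2) ≤ C * (2 * η) := h2
      _ = ε * (C / (C + 1)) := h3
      _ ≤ ε * 1 := by apply mul_le_mul_of_nonneg_left h4 hε.le
      _ = ε := mul_one ε
  have hs0 : 0 ≤ Real.sqrt ((((N : ℝ) + 1) * l ^ 3)⁻¹) + (((N : ℝ) + 1) * l ^ 3)⁻¹ := by positivity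
  have hkey : B * C * (Real.sqrt ((((N : ℝ) + 1) * l ^ 3)⁻¹) + (((N : ℝ) + 1) * l ^ 3)⁻¹ + η + min η 1 ^ 2) =
      B * (C * (Real.sqrt ((((N : ℝ) + 1) * l ^ 3)⁻¹) + (((N : ℝ) + 1) * l ^ 3)⁻¹)) + B * (C * (η + min η 1 ^ 2)) := by
    ring
  rw [hkey]
  have : B * (C * (η + min η 1 ^ 2)) ≤ B * ε := mul_le_mul_of_nonneg_left hbud hB0
  nlinarith [this]

end FluxClosureEq.G2
end Summit.AtomisticToContinuum.HydrodynamicLimit.Theorems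

end
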